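import Mathlib
import Literature.Analysis.FluidPDE.SelfSimilarEulerProfile
import Summits.NavierStokesRegularity.NavierStokesRegularity.Theorems.EulerZoomLiouvillePowerGaugeEulerLiouvilleHoopDefs

/-!
# Hoop line — the K-TJ′ face `HasStraightSlowHighRuns ρ c V` (definition only)

Sub-problem `NavierStokesRegularity`, crux `PowerGaugeEulerLiouville` (stmt-NavierStokesRegularity-19832; a crux CLASS, not NS regularity).
The face of the hoop-line member T-J′ (nsreg-p2 g39 K-TJ′ TEXT `r49/TJprime_Q.lean` sha16 ded0ed1693c65c3f, VERBATIM; ns-idea-11 HOOP-NOTE §6/§8/§10,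
ROUND-48 §2): «arbitrarily far out there is a straight, thin (radius `b = R^{−(1+ρ)}`), quiet-walled, slow ∧ Bernoulli-high run of length `≥ Λ·b`», with one
explicit constraint tying `Λ` to the class budget `c` and the run's constants.  Landed as a definition so that BOTH the member theorem
(`Loc.selfSimilar_ae_eq_zero_of_straightSlowHighRunsC2_profile`, hands) and the LEAD skeleton (`IsKinematicTameProfile ρ c V` alternative 8) reference it BY NAME.
Nothing is proved here; 19832 OPEN; NS regularity NOT proved.
-/

noncomputable section

set_option linter.dupNamespace false

open Set Metric MeasureTheory Function
open scoped RealInnerProductSpace ENNReal NNReal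

namespace Summit.NavierStokesRegularity.NavierStokesRegularity.Theorems.PowerGaugeEulerLiouville

open Literature.Analysis Literature.Analysis.FluidPDE

/-- **K-TJ′ FACE** «arbitrarily far out there is a straight, thin, quiet-walled, slow ∧ Bernoulli-high run of length `≥ Λ·b`,
`b = R^{−(1+ρ)}`», with ONE explicit constraint tying the length constant `Λ` to the budget `c`, the speed bound `K`, the slowness `λ`,
the ambient excess `η` and the wall speed `ν` (`γ = 1/(2+ρ)`):
`(1−ρ)c/(2+ρ) + 4K² + 4K < Λ·(½γ(1−γ) − ½λ² − η − ν²)`.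
Run = image under the rigid motion `x ↦ A x + a` of `HoopCore.solidCyl s₁ s₂ b` (axis `σ ↦ A (σ•e_z) + a`, wall circle
`θ ↦ A (axisPt σ b θ) + a`).  [nsreg-p2 g39 K-TJ′ TEXT; HOOP-NOTE §6 T-J′, §8(b), §10(a); ROUND-48 §2] -/
def HasStraightSlowHighRuns (ρ : ℝ) (c : ℝ≥0)
    (V : EuclideanSpace ℝ (Fin 3) → EuclideanSpace ℝ (Fin 3)) : Prop :=
  ∀ P' : EuclideanSpace ℝ (Fin 3) → ℝ, IsSelfSimilarEulerProfile (1 / (2 + ρ)) 0 V P' →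
    ∃ Λ lam η ν K : ℝ, 0 < Λ ∧ 0 ≤ lam ∧ 0 ≤ η ∧ 0 ≤ ν ∧ 0 ≤ K ∧
      (1 - ρ) * (c : ℝ) / (2 + ρ) + 4 * K ^ 2 + 4 * K
          < Λ * ((1 / (2 + ρ)) * (1 - 1 / (2 + ρ)) / 2 - lam ^ 2 / 2 - η - ν ^ 2) ∧
      ∀ R₀ : ℝ, ∃ (A : EuclideanSpace ℝ (Fin 3) ≃ₗᵢ[ℝ] EuclideanSpace ℝ (Fin 3)) (a : EuclideanSpace ℝ (Fin 3))
          (R s₁ s₂ h : ℝ),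
        R₀ ≤ R ∧ 1 ≤ R ∧ s₁ + Λ * R ^ (-(1 + ρ)) ≤ s₂ ∧
        (∀ x ∈ HoopCore.solidCyl s₁ s₂ (R ^ (-(1 + ρ))),
            R ≤ ‖A x + a‖ ∧ ‖A x + a‖ ≤ 2 * R ∧ ‖V (A x + a)‖ ≤ K * R) ∧
        (∀ σ ∈ Icc s₁ s₂,
            ‖selfSimilarTransport (1 / (2 + ρ)) 0 V (A (σ • eZ) + a)‖ ≤ lam * R ∧
            h ≤ selfSimilarBernoulli (1 / (2 + ρ)) 0 V P' (A (σ • eZ) + a) ∧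
            HoopCore.circleAvg (fun x => P' (A x + a)) σ (R ^ (-(1 + ρ))) ≤ h + η * R ^ 2 ∧
            ∀ θ : ℝ, ‖V (A (HoopCore.axisPt σ (R ^ (-(1 + ρ))) θ) + a)‖ ≤ ν * R)

end Summit.NavierStokesRegularity.NavierStokesRegularity.Theorems.PowerGaugeEulerLiouville

end
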